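/-
Copyright (c) 2026 the pub-hodgecm-mathlib formalisation cell (harness21).  Prover seat hodgecm-mathlib-K2-defs1 (g4), Track B ∕ K2-LIT,
h413 = `stmt-HodgeConjecture-24833`, line `K2_E1_TraceFormulaBeta`, page «EIS-RANK-ONE», deal U2 of RULING «CONSTANTS-FIRST» (dealer K2E1-plan (g4) 2026-09-04T07:06:19Z (b);
plan K2E4-p11 (g4) 07:05:55Z): the CONSTANTS-FIRST (family) re-edition of ★ p858073 `K2E1EisensteinMinusConstantTermDecayInputsU3` — same proofs, the decay constants
`C_E`, `B` bound BEFORE the section `f` and its archimedean data, so that they are uniform in `f = f_z`, `z ∈ Kc`.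
-/
import Summits.HodgeConjecture.HodgeConjecture.Theorems.K2E1EisensteinMinusConstantTermDecayInputsU3   -- ★ p858073 (this seat): the per-`f` edition; brings ★ p857966, ★ PART II, ★ (F1), ★ (E2), ★ FILE A∕B
import HarnessLib

/-!
# h413 ∕ Track B «K2-LIT», «EIS-RANK-ONE» U2 — `K2E1EisensteinMinusConstantTermDecayInputsFamilyU3`: the decay binders `hdecE` ∕ `hdecF` of
# ★ `forall_norm_sub_borelConstantTerm_le_three` with their constants bound FIRST (uniformly in the section `f` and its archimedean triples)

Cell `pub/hodgecm-mathlib`, crux H413 = `stmt-HodgeConjecture-24833`, route `HCCMUnconditional`; RULING «CONSTANTS-FIRST» (K2E1-plan (g4) 07:06:19Z): «state constants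
BEFORE the section∕parameter binders whenever the proof allows (`∃ C, ∀ f z …`, not `∀ f z, ∃ C`)»; U1 (PART II family) and U3 (the `Kc`-uniform assembly (R3u)₃) are
K2E4-p11 (g4)'s.  THEOREMS ONLY (no `def`, no `instance`, no `notation`, no named-fact hypothesis, no `sorry`); lane `--kind proof --supports stmt-HodgeConjecture-24833
--as helper` (count-neutral).  Generic over a quadratic extension `E ∕ F` of number fields with involution `c`, `c δ = -δ ≠ 0`.

WHY THE HOIST IS FREE.  In ★ p858073 the constants are assembled from data that never mention `f`: the level ideals `𝔪`, `𝔫` of the tube lemma (★ PART II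
`exists_levelIdeal_forall_adelicVal_conj_heisChart_mem_three`: they depend on the compact `K` and the open level `U₀` only), the envelope constants `c_E, C_f` ∕ `c_F, C_f`
of ★ (F1) `exists_envelope` (depend on the field, the measures, the ideal), the decay constants of ★ (E2) `exists_forall_tsum_indicator_norm_mul_le_rpow_neg` (on
`c_E·N₂E`, `C_f`, `m`) and ★ p857966 §4 `exists_forall_tsum_indicator_norm_mul_le_linear` (on `C_f`, `m`), and the shell constant `B_F`.  So `C_E = C_E(K, U₀, m, N₂E, μ's)`
and `B = c_F·C·B_F`; this file states exactly that.

* **`exists_forall_fourierDecay_centreAverage_three`** — `∃ C_E ≥ 0, ∀ {f} (hfc hfB hmaj hfU) {AE} (hAE : ∫ AE k ≤ N₂E) (hdecArchE), ‹hdecE of ★ p857799 with βE := m∕[E:ℚ]›`.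
* **`exists_forall_fourierDecay_centreLine_shell_three`** — `∃ B ≥ 0, ∀ {f} (hfc hfB hmaj hfU) {AF N₂F} (hN₂F0 hAF hdecArchF) (hshell : … ≤ B_F·(‖l₂‖⁻¹)^θ), ‹hdecF of ★ p857799
  with βF := m∕[F:ℚ]›`.
HONEST LABEL.  Count-neutral helper; proves no printed statement; HC_CM is proved only modulo the 7 printed citations (2 remaining named inputs: hLiu418 =
`stmt-HodgeConjecture-24832`, h413 = `stmt-HodgeConjecture-24833`) until rung 0 closes.

## References
* [MoeglinWaldspurger1995] C. Mœglin, J.-L. Waldspurger, *Spectral decomposition and Eisenstein series* (1995), I.2.10–I.2.12, II.1.7.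
* [Garrett2018] P. Garrett, *Modern Analysis of Automorphic Forms by Example* 1 (2018), §2.9, §12.2.
-/

set_option autoImplicit false
set_option linter.dupNamespace false  -- the mandated namespace repeats the summit's segment (`HodgeConjecture.HodgeConjecture`)

noncomputable section

open MeasureTheory Measure Filter Topology NumberField IsDedekindDomain MulAction Module
open Literature.NumberTheory.Automorphic Literature.NumberTheory.Automorphic.UnitaryGroup
open Summit.HodgeConjecture.HodgeConjecture.Cruxes.H413.K2E1AdelicFourierEnvelope
open Summit.HodgeConjecture.HodgeConjecture.Cruxes.H413.K2E1AdelicFourierDecay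
open Summit.HodgeConjecture.HodgeConjecture.Cruxes.H413.K2E1FlatSectionLineRestrictionU3
open Summit.HodgeConjecture.HodgeConjecture.Cruxes.H413.K2E1FlatSectionCentreAverageU3
open Summit.HodgeConjecture.HodgeConjecture.Cruxes.H413.K2E1FlatSectionLineRestrictionArchU3
open Summit.HodgeConjecture.HodgeConjecture.Cruxes.H413.K2E1EisensteinMinusConstantTermPoissonInputsU3
open NumberField.mixedEmbedding
-- `Classical` is needed to see the Mathlib normed-space instances on `mixedSpace` (note H5 of `AdelicGLnGlue`)
open scoped ENNReal NNReal Classical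

namespace Summit.HodgeConjecture.HodgeConjecture.Cruxes.H413.K2E1EisensteinMinusConstantTermDecayInputsFamilyU3

variable {F E : Type} [Field F] [NumberField F] [Field E] [NumberField E] [Algebra F E] [Algebra.IsQuadraticExtension F E] {c : E ≃ₐ[F] E} {δ : E}

/-! ## §1 `hdecE`, constants first -/

/-- **`hdecE` of ★ `forall_norm_sub_borelConstantTerm_le_three`, CONSTANTS FIRST**: `∃ C_E ≥ 0` depending only on `(K, U₀, m, N₂E)` and the measures such that for EVERY
continuous, left-`B_U(F)`-invariant, Godement-majorised, `U₀`-invariant `f` and EVERY archimedean E-layer triple of mass `≤ N₂E` the `hdecE` letter holds with that `C_E`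
(proof of ★ p858073 `exists_fourierDecay_centreAverage_three` with the `refine ⟨C, …⟩` hoisted). [cite: MoeglinWaldspurger1995, II.1.7] [cite: Garrett2018, §2.9] -/
theorem exists_forall_fourierDecay_centreAverage_three (hc : c * c = 1) (hcδ : c δ = -δ) (hδ : δ ≠ 0)
    [MeasurableSpace (AdeleRing (𝓞 F) F)] [BorelSpace (AdeleRing (𝓞 F) F)] [MeasurableSpace (AdeleRing (𝓞 E) E)] [BorelSpace (AdeleRing (𝓞 E) E)]
    [MeasurableSpace (InfiniteAdeleRing E)] [BorelSpace (InfiniteAdeleRing E)] [MeasurableSpace (FiniteAdeleRing (𝓞 E) E)] [BorelSpace (FiniteAdeleRing (𝓞 E) E)]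
    (μF : Measure (AdeleRing (𝓞 F) F)) [μF.IsAddHaarMeasure] (μE : Measure (AdeleRing (𝓞 E) E)) [μE.IsAddHaarMeasure]
    (μE₁ : Measure (InfiniteAdeleRing E)) [μE₁.IsAddHaarMeasure] (μE₂ : Measure (FiniteAdeleRing (𝓞 E) E)) [μE₂.IsAddHaarMeasure]
    {K : Set (quasiSplit F E c 3).Adelic} (hK : IsCompact K)
    {U₀ : Subgroup (GL (Fin 3) (FiniteAdeleRing (𝓞 E) E))} (hU₀o : IsOpen (U₀ : Set (GL (Fin 3) (FiniteAdeleRing (𝓞 E) E))))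
    {m : ℕ} (hm : (finrank ℚ E : ℝ) < m) {N₂E : ℝ} (hN₂E : 0 ≤ N₂E) :
    ∃ CE : ℝ, 0 ≤ CE ∧ ∀ {f : (quasiSplit F E c 3).Adelic → ℂ}, Continuous f →
      (∀ b ∈ borelU (c : E →+* E) ((StdForm.antidiagonal 3).over E), ∀ x : (quasiSplit F E c 3).Adelic, f ((quasiSplit F E c 3).toAdelic b * x) = f x) →
      (∀ y₀ : (quasiSplit F E c 3).Adelic, ∃ V ∈ 𝓝 y₀,
      ∃ u : Quotient (orbitRel ↥(borelU (c : E →+* E) ((StdForm.antidiagonal 3).over E)) ↥(unitaryGroupOfForm (c : E →+* E) ((StdForm.antidiagonal 3).over E))) → ℝ,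
        Summable u ∧ ∀ y ∈ V, ∀ q, ‖f ((quasiSplit F E c 3).toAdelic (q.out : ↥(unitaryGroupOfForm (c : E →+* E) ((StdForm.antidiagonal 3).over E))) * y)‖ ≤ u q) →
      (∀ u : (quasiSplit F E c 3).Adelic, adelicVal F E c 3 ((StdForm.antidiagonal 3).over E) u ∈ U₀.map (GLn.ofFinite 3 E) → ∀ y : (quasiSplit F E c 3).Adelic, f (y * u) = f y) →
      ∀ {AE : (quasiSplit F E c 3).Adelic → FiniteAdeleRing (𝓞 E) E → ℝ}, (∀ k ∈ K, Integrable (AE k) μE₂ ∧ ∫ B, AE k B ∂μE₂ ≤ N₂E) →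
      (∀ k ∈ K, ∀ (B : FiniteAdeleRing (𝓞 E) E) (Y : InfiniteAdeleRing E),
        ‖∫ a, (((μF (adeleFundamentalDomain F)).toReal⁻¹ : ℂ) * ∫ t, f (((quasiSplit F E c 3).toAdelic (weylLongU (c : E →+* E) (rfl : ((StdForm.antidiagonal 3).over E) = ((StdForm.antidiagonal 3).over E)))) * ((heisChart hc ((((a, B)) : AdeleRing (𝓞 E) E), traceZeroLine F E c hcδ hδ t) : ↥(adelicUnipotent F E c 3)) : (quasiSplit F E c 3).Adelic) * k) ∂μF) *
          (adeleAddChar E (infiniteAdeleInl E (Y * a)) : ℂ) ∂μE₁‖ ≤ AE k B * (1 + ‖InfiniteAdeleRing.ringEquiv_mixedSpace E Y‖) ^ (-(m : ℝ))) →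
      ∀ k ∈ K, ∀ l₁ : (AdeleRing (𝓞 E) E)ˣ, ((IdeleClassGroup.ideleNorm E l₁ : ℝ≥0) : ℝ) ≤ 1 →
      (Summable fun ξ : E =>
        ‖∫ V, (((μF (adeleFundamentalDomain F)).toReal⁻¹ : ℂ) * ∫ s, f (((quasiSplit F E c 3).toAdelic (weylLongU (c : E →+* E) (rfl : ((StdForm.antidiagonal 3).over E) = ((StdForm.antidiagonal 3).over E)))) * ((heisChart hc (V, traceZeroLine F E c hcδ hδ s) : ↥(adelicUnipotent F E c 3)) : (quasiSplit F E c 3).Adelic) * k) ∂μF) * (adeleAddChar E (algebraMap E (AdeleRing (𝓞 E) E) ξ * ((l₁⁻¹ : (AdeleRing (𝓞 E) E)ˣ) : AdeleRing (𝓞 E) E) * V) : ℂ) ∂μE‖) ∧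
      ∑' ξ : E, ({0}ᶜ : Set E).indicator (fun ξ =>
          ‖∫ V, (((μF (adeleFundamentalDomain F)).toReal⁻¹ : ℂ) * ∫ s, f (((quasiSplit F E c 3).toAdelic (weylLongU (c : E →+* E) (rfl : ((StdForm.antidiagonal 3).over E) = ((StdForm.antidiagonal 3).over E)))) * ((heisChart hc (V, traceZeroLine F E c hcδ hδ s) : ↥(adelicUnipotent F E c 3)) : (quasiSplit F E c 3).Adelic) * k) ∂μF) * (adeleAddChar E (algebraMap E (AdeleRing (𝓞 E) E) ξ * ((l₁⁻¹ : (AdeleRing (𝓞 E) E)ˣ) : AdeleRing (𝓞 E) E) * V) : ℂ) ∂μE‖) ξ ≤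
        CE * (((IdeleClassGroup.ideleNorm E l₁ : ℝ≥0) : ℝ)⁻¹) ^ (-((m : ℝ) / (finrank ℚ E : ℝ))) := by
  -- `f`-FREE data: the level subgroup of `U₀` in `G(𝔸)`, ONE level ideal `𝔪` of `E` for all of `K`, the envelope and decay constants
  set U : Subgroup (quasiSplit F E c 3).Adelic := (U₀.map (GLn.ofFinite 3 E)).comap (adelicVal F E c 3 ((StdForm.antidiagonal 3).over E)) with hUdef
  obtain ⟨𝔫, -, 𝔪, h𝔪, htube⟩ := exists_levelIdeal_forall_adelicVal_conj_heisChart_mem_three hc hcδ hδ hK hU₀o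
  have hθ0 : traceZeroLine F E c hcδ hδ ((((0 : InfiniteAdeleRing F), (0 : FiniteAdeleRing (𝓞 F) F)) : AdeleRing (𝓞 F) F)) = 0 := map_zero _
  obtain ⟨cE, hcE, Cf, hCfc, henv⟩ := exists_envelope E μE μE₁ μE₂ h𝔪
  have hM0 : 0 ≤ cE * N₂E := mul_nonneg hcE.le hN₂E
  have hmm : (m : ℝ) ≤ ((m : ℕ) : ℝ) := le_rfl
  obtain ⟨C, hC0, hdecay⟩ := exists_forall_tsum_indicator_norm_mul_le_rpow_neg E hM0 hCfc hm hmm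
  refine ⟨C, hC0, fun {f} hfc hfB hmaj hfU {AE} hAE hdecArchE k hk l₁ _ => ?_⟩
  have hfU' : ∀ v ∈ U, ∀ y : (quasiSplit F E c 3).Adelic, f (y * v) = f y := fun v hv y => hfU v (Subgroup.mem_comap.1 hv) y
  -- `Φ^Z_k` is `𝔪`-periodic in the finite coordinate (★ FILE B)
  have hper : ∀ (a : InfiniteAdeleRing E) (B Lf : FiniteAdeleRing (𝓞 E) E), Lf ∈ levelIdeal E 𝔪 →
      (((μF (adeleFundamentalDomain F)).toReal⁻¹ : ℂ) * ∫ t, f (((quasiSplit F E c 3).toAdelic (weylLongU (c : E →+* E) (rfl : ((StdForm.antidiagonal 3).over E) = ((StdForm.antidiagonal 3).over E)))) * ((heisChart hc ((((a, B + Lf)) : AdeleRing (𝓞 E) E), traceZeroLine F E c hcδ hδ t) : ↥(adelicUnipotent F E c 3)) : (quasiSplit F E c 3).Adelic) * k) ∂μF) =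
        (((μF (adeleFundamentalDomain F)).toReal⁻¹ : ℂ) * ∫ t, f (((quasiSplit F E c 3).toAdelic (weylLongU (c : E →+* E) (rfl : ((StdForm.antidiagonal 3).over E) = ((StdForm.antidiagonal 3).over E)))) * ((heisChart hc ((((a, B)) : AdeleRing (𝓞 E) E), traceZeroLine F E c hcδ hδ t) : ↥(adelicUnipotent F E c 3)) : (quasiSplit F E c 3).Adelic) * k) ∂μF) := by
    intro a B Lf hLf
    have hkU : k⁻¹ * ((heisChart hc ((((0 : InfiniteAdeleRing E), Lf) : AdeleRing (𝓞 E) E), (0 : traceZeroAdele F E c)) : ↥(adelicUnipotent F E c 3)) : (quasiSplit F E c 3).Adelic) * k ∈ U := by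
      have h' := htube k hk 0 (levelIdeal F 𝔫).zero_mem Lf hLf
      rw [hθ0] at h'
      exact Subgroup.mem_comap.2 h'
    have hpair : (((a, B + Lf)) : AdeleRing (𝓞 E) E) = ((a, B) : AdeleRing (𝓞 E) E) + (((0 : InfiniteAdeleRing E), Lf) : AdeleRing (𝓞 E) E) :=
      Prod.ext (add_zero a).symm rfl
    rw [hpair]
    exact congrArg (fun w : ℂ => ((μF (adeleFundamentalDomain F)).toReal⁻¹ : ℂ) * w) (integral_weylLongU_mul_heisChart_add_eq hc hcδ hδ μF hfU' hkU _)
  set Φ : AdeleRing (𝓞 E) E → ℂ := fun V => (((μF (adeleFundamentalDomain F)).toReal⁻¹ : ℂ) * ∫ s, f (((quasiSplit F E c 3).toAdelic (weylLongU (c : E →+* E) (rfl : ((StdForm.antidiagonal 3).over E) = ((StdForm.antidiagonal 3).over E)))) * ((heisChart hc (V, traceZeroLine F E c hcδ hδ s) : ↥(adelicUnipotent F E c 3)) : (quasiSplit F E c 3).Adelic) * k) ∂μF) with hΦ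
  have hΦprod : Integrable (fun p : InfiniteAdeleRing E × FiniteAdeleRing (𝓞 E) E => Φ (p.1, p.2)) (μE₁.prod μE₂) :=
    (integrable_iff_integrable_prod E μE μE₁ μE₂ Φ).1 (integrable_centreAverage_three hc hcδ hδ μF μE hfc hfB hmaj k)
  obtain ⟨hAk, hAN⟩ := hAE k hk
  obtain ⟨hMΨ, hCfΨ⟩ := henv Φ (AE k) N₂E m hΦprod (fun a B Lf hLf => hper a B Lf hLf) (fun B Y => hdecArchE k hk B Y) hAk hAN
  have h := hdecay (fun η => ∫ V, Φ V * (adeleAddChar E (η * V) : ℂ) ∂μE) hMΨ hCfΨ l₁⁻¹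
  rw [map_inv, NNReal.coe_inv] at h
  exact h

/-! ## §2 `hdecF`, constants first -/

/-- **`hdecF` of ★ `forall_norm_sub_borelConstantTerm_le_three`, CONSTANTS FIRST**: `∃ B ≥ 0` depending only on `(K, U₀, m, B_F)` and the measures (`B = c_F·C·B_F`) such that for
EVERY admissible `f`, EVERY F-layer triple (`AF`, `N₂F`) and EVERY shell bound `Σ_{x₀} N₂F k (l₁(x₀−Y)) ≤ B_F·(‖l₂‖⁻¹)^θ` the `hdecF` letter holds with that `B` (proof of ★ p858073
`exists_fourierDecay_centreLine_shell_three` with the `refine ⟨c_F·C·B_F, …⟩` hoisted; `θ` stays free AFTER `f` — it enters only through `hshell`). [cite: MoeglinWaldspurger1995, II.1.7] [cite: Garrett2018, §2.9] -/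
theorem exists_forall_fourierDecay_centreLine_shell_three (hc : c * c = 1) (hcδ : c δ = -δ) (hδ : δ ≠ 0)
    [MeasurableSpace (AdeleRing (𝓞 F) F)] [BorelSpace (AdeleRing (𝓞 F) F)]
    [MeasurableSpace (InfiniteAdeleRing F)] [BorelSpace (InfiniteAdeleRing F)] [MeasurableSpace (FiniteAdeleRing (𝓞 F) F)] [BorelSpace (FiniteAdeleRing (𝓞 F) F)]
    (μF : Measure (AdeleRing (𝓞 F) F)) [μF.IsAddHaarMeasure]
    (μF₁ : Measure (InfiniteAdeleRing F)) [μF₁.IsAddHaarMeasure] (μF₂ : Measure (FiniteAdeleRing (𝓞 F) F)) [μF₂.IsAddHaarMeasure]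
    {K : Set (quasiSplit F E c 3).Adelic} (hK : IsCompact K)
    {U₀ : Subgroup (GL (Fin 3) (FiniteAdeleRing (𝓞 E) E))} (hU₀o : IsOpen (U₀ : Set (GL (Fin 3) (FiniteAdeleRing (𝓞 E) E))))
    {m : ℕ} (hm : (finrank ℚ F : ℝ) < m) {BF : ℝ} (hBF : 0 ≤ BF) :
    ∃ B : ℝ, 0 ≤ B ∧ ∀ {f : (quasiSplit F E c 3).Adelic → ℂ}, Continuous f →
      (∀ b ∈ borelU (c : E →+* E) ((StdForm.antidiagonal 3).over E), ∀ x : (quasiSplit F E c 3).Adelic, f ((quasiSplit F E c 3).toAdelic b * x) = f x) →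
      (∀ y₀ : (quasiSplit F E c 3).Adelic, ∃ V ∈ 𝓝 y₀,
      ∃ u : Quotient (orbitRel ↥(borelU (c : E →+* E) ((StdForm.antidiagonal 3).over E)) ↥(unitaryGroupOfForm (c : E →+* E) ((StdForm.antidiagonal 3).over E))) → ℝ,
        Summable u ∧ ∀ y ∈ V, ∀ q, ‖f ((quasiSplit F E c 3).toAdelic (q.out : ↥(unitaryGroupOfForm (c : E →+* E) ((StdForm.antidiagonal 3).over E))) * y)‖ ≤ u q) →
      (∀ u : (quasiSplit F E c 3).Adelic, adelicVal F E c 3 ((StdForm.antidiagonal 3).over E) u ∈ U₀.map (GLn.ofFinite 3 E) → ∀ y : (quasiSplit F E c 3).Adelic, f (y * u) = f y) →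
      ∀ {AF : (quasiSplit F E c 3).Adelic → AdeleRing (𝓞 E) E → FiniteAdeleRing (𝓞 F) F → ℝ} {N₂F : (quasiSplit F E c 3).Adelic → AdeleRing (𝓞 E) E → ℝ}, (∀ k ∈ K, ∀ X : AdeleRing (𝓞 E) E, 0 ≤ N₂F k X) →
      (∀ k ∈ K, ∀ X : AdeleRing (𝓞 E) E, Integrable (AF k X) μF₂ ∧ ∫ b, AF k X b ∂μF₂ ≤ N₂F k X) →
      (∀ k ∈ K, ∀ (X : AdeleRing (𝓞 E) E) (b : FiniteAdeleRing (𝓞 F) F) (y : InfiniteAdeleRing F),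
        ‖∫ a, f (((quasiSplit F E c 3).toAdelic (weylLongU (c : E →+* E) (rfl : ((StdForm.antidiagonal 3).over E) = ((StdForm.antidiagonal 3).over E)))) * ((heisChart hc (X, traceZeroLine F E c hcδ hδ (((a, b)) : AdeleRing (𝓞 F) F)) : ↥(adelicUnipotent F E c 3)) : (quasiSplit F E c 3).Adelic) * k) *
          (adeleAddChar F (infiniteAdeleInl F (y * a)) : ℂ) ∂μF₁‖ ≤ AF k X b * (1 + ‖InfiniteAdeleRing.ringEquiv_mixedSpace F y‖) ^ (-(m : ℝ))) →
      ∀ {θ : ℝ}, (∀ k ∈ K, ∀ (l₁ : (AdeleRing (𝓞 E) E)ˣ) (l₂ : (AdeleRing (𝓞 F) F)ˣ) (Y : AdeleRing (𝓞 E) E), ((IdeleClassGroup.ideleNorm F l₂ : ℝ≥0) : ℝ) ≤ 1 → ((IdeleClassGroup.ideleNorm E l₁ : ℝ≥0) : ℝ) = ((IdeleClassGroup.ideleNorm F l₂ : ℝ≥0) : ℝ) →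
        (Summable fun x₀ : E => N₂F k ((l₁ : AdeleRing (𝓞 E) E) * (algebraMap E (AdeleRing (𝓞 E) E) x₀ - Y))) ∧
        ∑' x₀ : E, N₂F k ((l₁ : AdeleRing (𝓞 E) E) * (algebraMap E (AdeleRing (𝓞 E) E) x₀ - Y)) ≤ BF * (((IdeleClassGroup.ideleNorm F l₂ : ℝ≥0) : ℝ)⁻¹) ^ θ) →
      ∀ k ∈ K, ∀ (l₁ : (AdeleRing (𝓞 E) E)ˣ) (l₂ : (AdeleRing (𝓞 F) F)ˣ) (Y : AdeleRing (𝓞 E) E), ((IdeleClassGroup.ideleNorm F l₂ : ℝ≥0) : ℝ) ≤ 1 →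
      ((IdeleClassGroup.ideleNorm E l₁ : ℝ≥0) : ℝ) = ((IdeleClassGroup.ideleNorm F l₂ : ℝ≥0) : ℝ) →
      (∀ x₀ : E, Summable fun η : F =>
        ‖∫ v, f (((quasiSplit F E c 3).toAdelic (weylLongU (c : E →+* E) (rfl : ((StdForm.antidiagonal 3).over E) = ((StdForm.antidiagonal 3).over E)))) * ((heisChart hc (((l₁ : AdeleRing (𝓞 E) E) * (algebraMap E (AdeleRing (𝓞 E) E) x₀ - Y)), traceZeroLine F E c hcδ hδ v) : ↥(adelicUnipotent F E c 3)) : (quasiSplit F E c 3).Adelic) * k) * (adeleAddChar F (algebraMap F (AdeleRing (𝓞 F) F) η * ((l₂⁻¹ : (AdeleRing (𝓞 F) F)ˣ) : AdeleRing (𝓞 F) F) * v) : ℂ) ∂μF‖) ∧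
      (Summable fun x₀ : E => ∑' η : F, ({0}ᶜ : Set F).indicator (fun η =>
        ‖∫ v, f (((quasiSplit F E c 3).toAdelic (weylLongU (c : E →+* E) (rfl : ((StdForm.antidiagonal 3).over E) = ((StdForm.antidiagonal 3).over E)))) * ((heisChart hc (((l₁ : AdeleRing (𝓞 E) E) * (algebraMap E (AdeleRing (𝓞 E) E) x₀ - Y)), traceZeroLine F E c hcδ hδ v) : ↥(adelicUnipotent F E c 3)) : (quasiSplit F E c 3).Adelic) * k) * (adeleAddChar F (algebraMap F (AdeleRing (𝓞 F) F) η * ((l₂⁻¹ : (AdeleRing (𝓞 F) F)ˣ) : AdeleRing (𝓞 F) F) * v) : ℂ) ∂μF‖) η) ∧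
      ∑' x₀ : E, ∑' η : F, ({0}ᶜ : Set F).indicator (fun η =>
          ‖∫ v, f (((quasiSplit F E c 3).toAdelic (weylLongU (c : E →+* E) (rfl : ((StdForm.antidiagonal 3).over E) = ((StdForm.antidiagonal 3).over E)))) * ((heisChart hc (((l₁ : AdeleRing (𝓞 E) E) * (algebraMap E (AdeleRing (𝓞 E) E) x₀ - Y)), traceZeroLine F E c hcδ hδ v) : ↥(adelicUnipotent F E c 3)) : (quasiSplit F E c 3).Adelic) * k) * (adeleAddChar F (algebraMap F (AdeleRing (𝓞 F) F) η * ((l₂⁻¹ : (AdeleRing (𝓞 F) F)ˣ) : AdeleRing (𝓞 F) F) * v) : ℂ) ∂μF‖) η ≤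
        B * (((IdeleClassGroup.ideleNorm F l₂ : ℝ≥0) : ℝ)⁻¹) ^ θ * (((IdeleClassGroup.ideleNorm F l₂ : ℝ≥0) : ℝ)⁻¹) ^ (-((m : ℝ) / (finrank ℚ F : ℝ))) := by
  -- `f`-FREE data: the level subgroup, ONE level ideal `𝔫` of `F`, the envelope constants over `F`, the LINEAR decay constant
  set U : Subgroup (quasiSplit F E c 3).Adelic := (U₀.map (GLn.ofFinite 3 E)).comap (adelicVal F E c 3 ((StdForm.antidiagonal 3).over E)) with hUdef
  obtain ⟨𝔫, h𝔫, 𝔪, -, htube⟩ := exists_levelIdeal_forall_adelicVal_conj_heisChart_mem_three hc hcδ hδ hK hU₀o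
  have h0E : ((((0 : InfiniteAdeleRing E), (0 : FiniteAdeleRing (𝓞 E) E)) : AdeleRing (𝓞 E) E)) = 0 := Prod.mk_zero_zero
  obtain ⟨cF, hcF, Cf, hCfc, henv⟩ := exists_envelope F μF μF₁ μF₂ h𝔫
  have hmm : (m : ℝ) ≤ ((m : ℕ) : ℝ) := le_rfl
  obtain ⟨C, hC0, hlin⟩ := exists_forall_tsum_indicator_norm_mul_le_linear F hCfc hm hmm
  refine ⟨cF * C * BF, mul_nonneg (mul_nonneg hcF.le hC0) hBF,
    fun {f} hfc hfB hmaj hfU {AF} {N₂F} hN₂F0 hAF hdecArchF {θ} hshell k hk l₁ l₂ Y hl₂ hl => ?_⟩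
  have hfU' : ∀ v ∈ U, ∀ y : (quasiSplit F E c 3).Adelic, f (y * v) = f y := fun v hv y => hfU v (Subgroup.mem_comap.1 hv) y
  -- the centre lines are `𝔫`-periodic in the finite coordinate (★ FILE A), for every centre `X`
  have hper : ∀ (X : AdeleRing (𝓞 E) E) (a : InfiniteAdeleRing F) (b l : FiniteAdeleRing (𝓞 F) F), l ∈ levelIdeal F 𝔫 →
      f (((quasiSplit F E c 3).toAdelic (weylLongU (c : E →+* E) (rfl : ((StdForm.antidiagonal 3).over E) = ((StdForm.antidiagonal 3).over E)))) * ((heisChart hc (X, traceZeroLine F E c hcδ hδ (((a, b + l)) : AdeleRing (𝓞 F) F)) : ↥(adelicUnipotent F E c 3)) : (quasiSplit F E c 3).Adelic) * k) =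
        f (((quasiSplit F E c 3).toAdelic (weylLongU (c : E →+* E) (rfl : ((StdForm.antidiagonal 3).over E) = ((StdForm.antidiagonal 3).over E)))) * ((heisChart hc (X, traceZeroLine F E c hcδ hδ (((a, b)) : AdeleRing (𝓞 F) F)) : ↥(adelicUnipotent F E c 3)) : (quasiSplit F E c 3).Adelic) * k) := by
    intro X a b l hl
    have hkU : k⁻¹ * ((heisChart hc ((0 : AdeleRing (𝓞 E) E), traceZeroLine F E c hcδ hδ ((((0 : InfiniteAdeleRing F), l)) : AdeleRing (𝓞 F) F)) : ↥(adelicUnipotent F E c 3)) : (quasiSplit F E c 3).Adelic) * k ∈ U := by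
      have h' := htube k hk l hl 0 (levelIdeal E 𝔪).zero_mem
      rw [h0E] at h'
      exact Subgroup.mem_comap.2 h'
    have hpair : (((a, b + l)) : AdeleRing (𝓞 F) F) = ((a, b) : AdeleRing (𝓞 F) F) + (((0 : InfiniteAdeleRing F), l) : AdeleRing (𝓞 F) F) :=
      Prod.ext (add_zero a).symm rfl
    rw [hpair]
    exact apply_weylLongU_mul_heisChart_add_eq hc hcδ hδ hfU' hkU X _
  -- per centre `X`
  have hX : ∀ X : AdeleRing (𝓞 E) E,
      (Summable fun η : F => ‖∫ v, f (((quasiSplit F E c 3).toAdelic (weylLongU (c : E →+* E) (rfl : ((StdForm.antidiagonal 3).over E) = ((StdForm.antidiagonal 3).over E)))) * ((heisChart hc (X, traceZeroLine F E c hcδ hδ v) : ↥(adelicUnipotent F E c 3)) : (quasiSplit F E c 3).Adelic) * k) * (adeleAddChar F (algebraMap F (AdeleRing (𝓞 F) F) η * ((l₂⁻¹ : (AdeleRing (𝓞 F) F)ˣ) : AdeleRing (𝓞 F) F) * v) : ℂ) ∂μF‖) ∧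
      ∑' η : F, ({0}ᶜ : Set F).indicator (fun η => ‖∫ v, f (((quasiSplit F E c 3).toAdelic (weylLongU (c : E →+* E) (rfl : ((StdForm.antidiagonal 3).over E) = ((StdForm.antidiagonal 3).over E)))) * ((heisChart hc (X, traceZeroLine F E c hcδ hδ v) : ↥(adelicUnipotent F E c 3)) : (quasiSplit F E c 3).Adelic) * k) * (adeleAddChar F (algebraMap F (AdeleRing (𝓞 F) F) η * ((l₂⁻¹ : (AdeleRing (𝓞 F) F)ˣ) : AdeleRing (𝓞 F) F) * v) : ℂ) ∂μF‖) η ≤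
        cF * N₂F k X * C * (((IdeleClassGroup.ideleNorm F l₂ : ℝ≥0) : ℝ)⁻¹) ^ (-((m : ℝ) / (finrank ℚ F : ℝ))) := by
    intro X
    set Φ : AdeleRing (𝓞 F) F → ℂ := fun v => f (((quasiSplit F E c 3).toAdelic (weylLongU (c : E →+* E) (rfl : ((StdForm.antidiagonal 3).over E) = ((StdForm.antidiagonal 3).over E)))) * ((heisChart hc (X, traceZeroLine F E c hcδ hδ v) : ↥(adelicUnipotent F E c 3)) : (quasiSplit F E c 3).Adelic) * k) with hΦ
    have hΦprod : Integrable (fun p : InfiniteAdeleRing F × FiniteAdeleRing (𝓞 F) F => Φ (p.1, p.2)) (μF₁.prod μF₂) :=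
      (integrable_iff_integrable_prod F μF μF₁ μF₂ Φ).1 (integrable_centreLine_three hc hcδ hδ μF hfc hfB hmaj X k)
    obtain ⟨hAk, hAN⟩ := hAF k hk X
    obtain ⟨hMΨ, hCfΨ⟩ := henv Φ (AF k X) (N₂F k X) m hΦprod (fun a b l hl => hper X a b l hl) (fun b y => hdecArchF k hk X b y) hAk hAN
    have h := hlin (cF * N₂F k X) (mul_nonneg hcF.le (hN₂F0 k hk X)) (fun η => ∫ v, Φ v * (adeleAddChar F (η * v) : ℂ) ∂μF) hMΨ hCfΨ l₂⁻¹
    rw [map_inv, NNReal.coe_inv] at h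
    exact h
  -- the shell sum
  obtain ⟨hNs, hNle⟩ := hshell k hk l₁ l₂ Y hl₂ hl
  have hr : 0 ≤ (((IdeleClassGroup.ideleNorm F l₂ : ℝ≥0) : ℝ)⁻¹) ^ (-((m : ℝ) / (finrank ℚ F : ℝ))) := Real.rpow_nonneg (inv_nonneg.2 (NNReal.coe_nonneg _)) _
  have hS : Summable fun x₀ : E => ∑' η : F, ({0}ᶜ : Set F).indicator (fun η =>
      ‖∫ v, f (((quasiSplit F E c 3).toAdelic (weylLongU (c : E →+* E) (rfl : ((StdForm.antidiagonal 3).over E) = ((StdForm.antidiagonal 3).over E)))) * ((heisChart hc (((l₁ : AdeleRing (𝓞 E) E) * (algebraMap E (AdeleRing (𝓞 E) E) x₀ - Y)), traceZeroLine F E c hcδ hδ v) : ↥(adelicUnipotent F E c 3)) : (quasiSplit F E c 3).Adelic) * k) * (adeleAddChar F (algebraMap F (AdeleRing (𝓞 F) F) η * ((l₂⁻¹ : (AdeleRing (𝓞 F) F)ˣ) : AdeleRing (𝓞 F) F) * v) : ℂ) ∂μF‖) η := by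
    refine Summable.of_nonneg_of_le (fun x₀ => tsum_nonneg fun η => Set.indicator_nonneg (fun _ _ => norm_nonneg _) η) (fun x₀ => (hX _).2) ?_
    exact ((hNs.mul_left cF).mul_right C).mul_right _
  refine ⟨fun x₀ => (hX _).1, hS, ?_⟩
  calc ∑' x₀ : E, ∑' η : F, ({0}ᶜ : Set F).indicator (fun η => ‖∫ v, f (((quasiSplit F E c 3).toAdelic (weylLongU (c : E →+* E) (rfl : ((StdForm.antidiagonal 3).over E) = ((StdForm.antidiagonal 3).over E)))) * ((heisChart hc (((l₁ : AdeleRing (𝓞 E) E) * (algebraMap E (AdeleRing (𝓞 E) E) x₀ - Y)), traceZeroLine F E c hcδ hδ v) : ↥(adelicUnipotent F E c 3)) : (quasiSplit F E c 3).Adelic) * k) * (adeleAddChar F (algebraMap F (AdeleRing (𝓞 F) F) η * ((l₂⁻¹ : (AdeleRing (𝓞 F) F)ˣ) : AdeleRing (𝓞 F) F) * v) : ℂ) ∂μF‖) η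
      ≤ ∑' x₀ : E, cF * N₂F k ((l₁ : AdeleRing (𝓞 E) E) * (algebraMap E (AdeleRing (𝓞 E) E) x₀ - Y)) * C * (((IdeleClassGroup.ideleNorm F l₂ : ℝ≥0) : ℝ)⁻¹) ^ (-((m : ℝ) / (finrank ℚ F : ℝ))) :=
        Summable.tsum_le_tsum (fun x₀ => (hX _).2) hS (((hNs.mul_left cF).mul_right C).mul_right _)
    _ = cF * C * (((IdeleClassGroup.ideleNorm F l₂ : ℝ≥0) : ℝ)⁻¹) ^ (-((m : ℝ) / (finrank ℚ F : ℝ))) * ∑' x₀ : E, N₂F k ((l₁ : AdeleRing (𝓞 E) E) * (algebraMap E (AdeleRing (𝓞 E) E) x₀ - Y)) := by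
        rw [← tsum_mul_left]; exact tsum_congr fun x₀ => by ring
    _ ≤ cF * C * (((IdeleClassGroup.ideleNorm F l₂ : ℝ≥0) : ℝ)⁻¹) ^ (-((m : ℝ) / (finrank ℚ F : ℝ))) * (BF * (((IdeleClassGroup.ideleNorm F l₂ : ℝ≥0) : ℝ)⁻¹) ^ θ) :=
        mul_le_mul_of_nonneg_left hNle (mul_nonneg (mul_nonneg hcF.le hC0) hr)
    _ = cF * C * BF * (((IdeleClassGroup.ideleNorm F l₂ : ℝ≥0) : ℝ)⁻¹) ^ θ * (((IdeleClassGroup.ideleNorm F l₂ : ℝ≥0) : ℝ)⁻¹) ^ (-((m : ℝ) / (finrank ℚ F : ℝ))) := by ring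

end Summit.HodgeConjecture.HodgeConjecture.Cruxes.H413.K2E1EisensteinMinusConstantTermDecayInputsFamilyU3

end
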